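import Mathlib
import HarnessLib
import Summits.HubbardSuperconductivity.HubbardSuperconductivity.Theorems.KLProgrammeKLRegimeCountertermContinuationHA

/-!
# Route `KLProgramme` — child `KLRegimeCounterterm` of crux K3, ANY GENERATION: THE ONE-VOLUME CONSTRUCTION ON THE MINIMAL CONSUMED BLOCK
# (seat hubbard-kl-k3c3-p2, «fixed point on FrameOK's tube, contraction in the frame norm»)

Second half of `…CountertermContinuationHA` (twin of `…CountertermOneVolumeH` on the minimal consumed block): the READING hypothesis of the
continuation from a block whose angular clause `Ang K n` is ANY predicate implying a `Λ`-Lipschitz bound of `θ ↦ ν_n(K)(θ)` (`ct_reading_of_blockHA`;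
the (E3g) conjunct `TwoLegAngularG` with `Λ = angBar … 1` is one instance, a re-typed majorant another), and **`ct_oneVolume_thresholdsHA`** —
child 2's constants and ONE volume, chosen before the block, the history `H`, the angular clause `Ang` are seen (only `Λ` is fixed first), at which
ANY such block for the package `ctRenMs G` yields an admissible half-tolerance frame with `CL n / L₀` in the other half.  Proofs only; nothing is
asserted about the Hubbard model.
-/

noncomputable section

namespace Summit.HubbardSuperconductivity.HubbardSuperconductivity.Theorems.KLRegimeSplit

set_option linter.dupNamespace false -- summit = problem name (single-conjunct summit), D-0017

open Real Finset
open Literature.MathematicalPhysics.QuantumLattice Literature.Probability.LatticeModels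
open Summit.HubbardSuperconductivity.HubbardSuperconductivity.Theorems.KLProgrammeLegKernels

/-! ## §1 The reading hypothesis from a minimal block, and the thresholds of the one-volume construction -/

section Reading

variable {L M : ℕ} [NeZero L] [NeZero M] {G : GeoConsts} {Q : EngConsts} {β U μ : ℝ} {R : RenConsts}
  {H Ang : TrigPolyC4v → ℕ → Prop} {Λ : ℝ}

/-- **THE READING OF THE CONTINUATION, from a minimal block and the frame-keyed reading inequality** (`…CountertermOneVolumeH` verbatim up
to the source of the angular constant; any package `R`): the block's angular clause supplies `Λ_ν = max Λ 0` and its sizes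
`Λ_ℓ = Σ_{i≤n} twoLegBar 1 i ≤ (4/3)(S 1+S′ 1|U|)U²` ((E3a) `j = 1`); a sup bound `B` of the partial sum gives `|ν_n(K)(θ)| ≤ B + W/L`,
`W = (4/3)(S 1+S′ 1|U|)U²·2π + (max Λ 0 + Λ_K)·π·(2π/r₀)`. -/
theorem ct_reading_of_blockHA (hG : G.WF) (hQ : Q.WF)
    (hAng : ∀ K : TrigPolyC4v, ∀ n : ℕ, Ang K n → ∀ a b : ℝ,
      |klLocalPart L M β U μ K n a - klLocalPart L M β U μ K n b| ≤ Λ * |a - b|)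
    (blk : ∀ K : TrigPolyC4v, FrameOK R U (nScales β) μ K → ∀ n : ℕ, n ≤ nScales β →
      (∀ j < n, RenormalisedAtF L M β U μ K R j) →
        TwoLegSizesG L M G Q R β U μ K n ∧ FrameLipschitzG L M H G Q R β U μ K n ∧ TwoLegSizesMS L M G Q R β U μ K n ∧
          Ang K n ∧ (RenormalisedAtF L M β U μ K R n → H K n))
    {ΛK r₀ : ℝ} (hr₀ : 0 < r₀)
    (rd : ∀ K : TrigPolyC4v, FrameOK R U (nScales β) μ K → ∀ (n : ℕ) (Λν : ℝ), 0 ≤ Λν →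
      (∀ a' b', |klLocalPart L M β U μ K n a' - klLocalPart L M β U μ K n b'| ≤ Λν * |a' - b'|) →
      ∀ Λℓ : ℝ, 0 ≤ Λℓ →
        (∀ p p' : Fin 2 → ℝ, |∑ i ∈ range (n + 1), (klTwoLegPieceG L M β U μ K i).eval p -
          ∑ i ∈ range (n + 1), (klTwoLegPieceG L M β U μ K i).eval p'| ≤ Λℓ * (|p 0 - p' 0| + |p 1 - p' 1|)) →
      ∀ θ : ℝ, |klLocalPart L M β U μ K n θ| ≤
        |K.eval (klFermiPoint μ K θ) + ∑ i ∈ range (n + 1), (klTwoLegPieceG L M β U μ K i).eval (klFermiPoint μ K θ)| +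
          (Λℓ * (2 * π / L) + (Λν + ΛK) * π * (2 * (π / L) / r₀)))
    {K : TrigPolyC4v} (hK : FrameOK R U (nScales β) μ K) {n : ℕ} (hn : n ≤ nScales β)
    (hren : ∀ j < n, RenormalisedAtF L M β U μ K R j) {B : ℝ}
    (hB : ∀ q : Fin 2 → ℝ, |K.eval q + ∑ i ∈ range (n + 1), (klTwoLegPieceG L M β U μ K i).eval q| ≤ B) (θ : ℝ) :
    |klLocalPart L M β U μ K n θ| ≤ B +
      (4 / 3 * (G.S 1 + Q.S' 1 * |U|) * U ^ 2 * (2 * π) + (max Λ 0 + ΛK) * π * (2 * π / r₀)) / L := by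
  have hS1 : 0 ≤ G.S 1 := hG.2.2.2.2.2.2.2.2.2.2.2.2.2.2.2.2.2.1 1
  have hS'1 : 0 ≤ Q.S' 1 := hQ.2.2.2.2.1 1
  have hLpos : (0 : ℝ) < L := Nat.cast_pos.2 (Nat.pos_of_ne_zero (NeZero.ne L))
  have hslot := blk K hK n hn hren
  have hang : ∀ a b : ℝ, |klLocalPart L M β U μ K n a - klLocalPart L M β U μ K n b| ≤ max Λ 0 * |a - b| := fun a b =>
    (hAng K n hslot.2.2.2.1 a b).trans (mul_le_mul_of_nonneg_right (le_max_left _ _) (abs_nonneg _))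
  have hΛν0 : 0 ≤ max Λ 0 := le_max_right _ _
  have hsizes : ∀ i ≤ n, TwoLegSizesG L M G Q R β U μ K i := fun i hi =>
    (blk K hK i (hi.trans hn) fun j hj => hren j (lt_of_lt_of_le hj hi)).1
  have hΛℓ'0 : 0 ≤ ∑ i ∈ range (n + 1), twoLegBar G Q U 1 i := sum_nonneg fun i _ => twoLegBar_nonneg' hG hQ U 1 i
  have hΛℓ'le : ∑ i ∈ range (n + 1), twoLegBar G Q U 1 i ≤ 4 / 3 * (G.S 1 + Q.S' 1 * |U|) * U ^ 2 :=
    sum_twoLegBar_one_le G Q U (by positivity) (n + 1)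
  have hmain := rd K hK n _ hΛν0 hang _ hΛℓ'0 (abs_partialSum_sub_le_of_sizes (L := L) (M := M) hsizes) θ
  have hBq := hB (klFermiPoint μ K θ)
  have hπL : 0 ≤ 2 * π / (L : ℝ) := by positivity
  have h1 : (∑ i ∈ range (n + 1), twoLegBar G Q U 1 i) * (2 * π / L) ≤ 4 / 3 * (G.S 1 + Q.S' 1 * |U|) * U ^ 2 * (2 * π / L) :=
    mul_le_mul_of_nonneg_right hΛℓ'le hπL
  have e : (4 / 3 * (G.S 1 + Q.S' 1 * |U|) * U ^ 2 * (2 * π) + (max Λ 0 + ΛK) * π * (2 * π / r₀)) / L =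
      4 / 3 * (G.S 1 + Q.S' 1 * |U|) * U ^ 2 * (2 * π / L) +
        (max Λ 0 + ΛK) * π * (2 * (π / L) / r₀) := by
    field_simp
  rw [e]
  linarith

end Reading

/-- **THE THRESHOLDS AND THE ONE-VOLUME CONSTRUCTION OF CHILD COUNTERTERM on the minimal consumed block — PROVED.**  For well-formed
`(G, Q)` there are `c₁ > 0` and, for `0 < c ≤ c₁`, `U₀ > 0` such that in the regime (`μ ∈ klWindowC`, `0 < U ≤ U₀`, `klBetaMin ≤ β ≤ exp(c/U²)`),
for every threshold pair `(Lh, Mh)`, Matsubara threshold `M0 : ℕ → ℕ`, family of nonnegative rate numerators `CL : ℕ → ℝ` and ANGULAR LIPSCHITZ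
CONSTANT `Λ : ℝ` (any real; all chosen before the volume), there is ONE volume `(L₀, M₀)` with `0 < L₀`, `0 < M₀`, `Lh ≤ L₀`, `Mh L₀ ≤ M₀`,
`M0 L₀ ≤ M₀`, `CL n / L₀ ≤ ½·tol_n` (`n ≤ nScales β`), at which EVERY minimal block for child 2's package `ctRenMs G` — any history
`H : TrigPolyC4v → ℕ → Prop`, any angular clause `Ang : TrigPolyC4v → ℕ → Prop` implying that `θ ↦ ν_n(K)(θ)` is `Λ`-Lipschitz — yields an
admissible frame whose local parts are within HALF the quadratic tolerance `ctCr G·|U|·Λ_n²/e₀` at every scale `n ≤ nScales β` and every real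
angle. -/
theorem ct_oneVolume_thresholdsHA (G : GeoConsts) (Q : EngConsts) (hG : G.WF) (hQ : Q.WF) :
    ∃ c₁ : ℝ, 0 < c₁ ∧ ∀ c : ℝ, 0 < c → c ≤ c₁ → ∃ U₀ : ℝ, 0 < U₀ ∧
      ∀ μ ∈ klWindowC, ∀ U : ℝ, 0 < U → U ≤ U₀ → ∀ β : ℝ, klBetaMin ≤ β → β ≤ Real.exp (c / U ^ 2) →
        ∀ (Lh : ℕ) (Mh M0 : ℕ → ℕ) (CL : ℕ → ℝ) (Λ : ℝ), (∀ n, 0 ≤ CL n) →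
          ∃ (L₀ M₀ : ℕ), 0 < L₀ ∧ 0 < M₀ ∧ Lh ≤ L₀ ∧ Mh L₀ ≤ M₀ ∧ M0 L₀ ≤ M₀ ∧
            (∀ n ≤ nScales β, CL n / L₀ ≤ ctCr G * |U| * klScale klE0 n ^ 2 / klE0 / 2) ∧
            ∀ (_ : NeZero L₀) (_ : NeZero M₀) (H Ang : TrigPolyC4v → ℕ → Prop),
              (∀ K : TrigPolyC4v, ∀ n : ℕ, Ang K n → ∀ a b : ℝ,
                |klLocalPart L₀ M₀ β U μ K n a - klLocalPart L₀ M₀ β U μ K n b| ≤ Λ * |a - b|) →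
              (∀ K : TrigPolyC4v, FrameOK (ctRenMs G) U (nScales β) μ K → ∀ n : ℕ, n ≤ nScales β →
                (∀ j < n, RenormalisedAtF L₀ M₀ β U μ K (ctRenMs G) j) →
                  TwoLegSizesG L₀ M₀ G Q (ctRenMs G) β U μ K n ∧ FrameLipschitzG L₀ M₀ H G Q (ctRenMs G) β U μ K n ∧
                    TwoLegSizesMS L₀ M₀ G Q (ctRenMs G) β U μ K n ∧ Ang K n ∧
                      (RenormalisedAtF L₀ M₀ β U μ K (ctRenMs G) n → H K n)) →
              ∃ K : TrigPolyC4v, FrameOK (ctRenMs G) U (nScales β) μ K ∧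
                ∀ n ≤ nScales β, ∀ θ : ℝ, |klLocalPart L₀ M₀ β U μ K n θ| ≤ ctCr G * |U| * klScale klE0 n ^ 2 / klE0 / 2 := by
  have hR : ∀ j, 0 ≤ (ctRenMs G).Gfr j := (ctRenMs_WF2 hG).1.2.2
  have hS0 : 0 ≤ G.S 0 := hG.2.2.2.2.2.2.2.2.2.2.2.2.2.2.2.2.2.1 0
  have hS1 : 0 ≤ G.S 1 := hG.2.2.2.2.2.2.2.2.2.2.2.2.2.2.2.2.2.1 1
  have hS'0 : 0 ≤ Q.S' 0 := hQ.2.2.2.2.1 0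
  have hS'1 : 0 ≤ Q.S' 1 := hQ.2.2.2.2.1 1
  have hSL : 0 ≤ G.SL := hG.2.2.2.2.2.2.2.2.2.2.2.2.2.2.2.2.2.2.2
  have hSL' : 0 ≤ Q.SL := hQ.2.2.2.2.2.2.1
  -- the thresholds of the self-map and of the reading
  obtain ⟨c₂, hc₂, U₂, hU₂, thr⟩ := ctRenMs_thresholds (G := G) (Q := Q) hG hQ
  obtain ⟨c₃, hc₃, U₃, hU₃, ΛK, hΛK, r₀, hr₀, read⟩ := abs_klLocalPart_le_of_partialSum_frameOK (ctRenMs G) hR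
  refine ⟨min c₂ c₃, lt_min hc₂ hc₃, fun c hc hcle => ?_⟩
  have hu₄pos : 0 < 1 / (10 * (Q.S' 0 + 1)) := by positivity
  have hu₅pos : 0 < 3 / (4000 * (G.SL + Q.SL + 1)) := by positivity
  refine ⟨min (min U₂ U₃) (min (min (1 / (10 * (Q.S' 0 + 1))) (3 / (4000 * (G.SL + Q.SL + 1)))) 1),
    lt_min (lt_min hU₂ hU₃) (lt_min (lt_min hu₄pos hu₅pos) one_pos), ?_⟩
  intro μ hμ U hU hUle β hβ hβc Lh Mh M0 CL Λ hCL
  have hU2 : U ≤ U₂ := hUle.trans ((min_le_left _ _).trans (min_le_left _ _))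
  have hU3 : U ≤ U₃ := hUle.trans ((min_le_left _ _).trans (min_le_right _ _))
  have hU4 : U ≤ 1 / (10 * (Q.S' 0 + 1)) := hUle.trans ((min_le_right _ _).trans ((min_le_left _ _).trans (min_le_left _ _)))
  have hU5 : U ≤ 3 / (4000 * (G.SL + Q.SL + 1)) :=
    hUle.trans ((min_le_right _ _).trans ((min_le_left _ _).trans (min_le_right _ _)))
  have hU1 : U ≤ 1 := hUle.trans ((min_le_right _ _).trans (min_le_right _ _))
  have hS0' : Q.S' 0 * |U| ≤ 1 / 10 := sPrime_zero_mul_abs_le hS'0 hU hU4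
  have hq : 4 / 3 * (G.SL + Q.SL * |U|) * |U| ≤ 1 / 1000 := contraction_le hSL hSL' hU hU1 hU5
  obtain ⟨hroomA, hroomB, h0, h1, h2⟩ := thr c U β hc.le (hcle.trans (min_le_left _ _)) hU hU2 hβ hβc
  -- the wiggle budget and the construction volume
  set W : ℝ := 4 / 3 * (G.S 1 + Q.S' 1 * |U|) * U ^ 2 * (2 * π) +
    (max Λ 0 + ΛK) * π * (2 * π / r₀) with hW
  have hW0 : 0 ≤ W := by
    have := le_max_right Λ 0
    rw [hW]; positivity
  obtain ⟨Lr, hLr⟩ := exists_nat_gt (2 * π / r₀)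
  have htpos : ∀ n ≤ nScales β,
      0 < min (|U| * ((16 : ℝ) ^ n)⁻¹ / 256) (ctCr G * |U| * klScale klE0 n ^ 2 / klE0 / 2) := by
    intro n _
    have hUa : 0 < |U| := abs_pos.2 hU.ne'
    have hcr0 : 0 < ctCr G := by unfold ctCr; positivity
    have he0 : (0 : ℝ) < klE0 := by norm_num [klE0]
    have hΛ : 0 < klScale klE0 n := by unfold klScale; positivity
    exact lt_min (by positivity) (by positivity)
  obtain ⟨L₀, hL₀pos, hL₀min, hL₀rate⟩ :=
    exists_volume_threshold (N := nScales β) (a := fun n => W + CL n)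
      (t := fun n => min (|U| * ((16 : ℝ) ^ n)⁻¹ / 256) (ctCr G * |U| * klScale klE0 n ^ 2 / klE0 / 2))
      (fun n _ => add_nonneg hW0 (hCL n)) htpos (max Lh (max 503 (Lr + 1)))
  have hLh : Lh ≤ L₀ := (le_max_left _ _).trans hL₀min
  have h503 : 503 ≤ L₀ := ((le_max_left _ _).trans (le_max_right _ _)).trans hL₀min
  have hLrL : Lr + 1 ≤ L₀ := ((le_max_right _ _).trans (le_max_right _ _)).trans hL₀min
  have hL₀R : (503 : ℝ) ≤ L₀ := by exact_mod_cast h503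
  have hL₀posR : (0 : ℝ) < L₀ := by linarith
  have h20 : (20 : ℝ) ≤ L₀ := by linarith
  have hflat : 8 * π / klFlatR ≤ L₀ := eight_pi_div_klFlatR_le.trans hL₀R
  have hLu : 2 * π / (L₀ : ℝ) < r₀ := two_pi_div_lt_of_floor hr₀ hLr hLrL
  have hM₀pos : 0 < max (Mh L₀) (M0 L₀) + 1 := Nat.succ_pos _
  -- the two families of rates fit
  have hsplit : ∀ n ≤ nScales β, W / L₀ ≤ |U| * ((16 : ℝ) ^ n)⁻¹ / 256 ∧
      CL n / L₀ ≤ ctCr G * |U| * klScale klE0 n ^ 2 / klE0 / 2 := by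
    intro n hn
    have h := hL₀rate n hn
    have hWle : W / (L₀ : ℝ) ≤ (W + CL n) / L₀ := div_le_div_of_nonneg_right (by linarith [hCL n]) hL₀posR.le
    have hCle : CL n / (L₀ : ℝ) ≤ (W + CL n) / L₀ := div_le_div_of_nonneg_right (by linarith) hL₀posR.le
    exact ⟨(hWle.trans h).trans (min_le_left _ _), (hCle.trans h).trans (min_le_right _ _)⟩
  refine ⟨L₀, max (Mh L₀) (M0 L₀) + 1, hL₀pos, hM₀pos, hLh, (le_max_left _ _).trans (Nat.le_succ _),
    (le_max_right _ _).trans (Nat.le_succ _), fun n hn => (hsplit n hn).2, ?_⟩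
  intro _ _ H Ang hAng blk
  -- the reading at the construction volume
  have hread : ∀ K : TrigPolyC4v, FrameOK (ctRenMs G) U (nScales β) μ K → ∀ n : ℕ, n ≤ nScales β →
      (∀ j < n, RenormalisedAtF L₀ (max (Mh L₀) (M0 L₀) + 1) β U μ K (ctRenMs G) j) → ∀ B : ℝ,
        (∀ q : Fin 2 → ℝ, |K.eval q + ∑ i ∈ range (n + 1),
          (klTwoLegPieceG L₀ (max (Mh L₀) (M0 L₀) + 1) β U μ K i).eval q| ≤ B) →
          ∀ θ : ℝ, |klLocalPart L₀ (max (Mh L₀) (M0 L₀) + 1) β U μ K n θ| ≤ B + W / L₀ := by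
    intro K hK n hn hren B hB θ
    exact ct_reading_of_blockHA (L := L₀) (M := max (Mh L₀) (M0 L₀) + 1) hG hQ hAng blk hr₀
      (fun K hK n Λν hΛν hLip Λℓ hΛℓ hLipℓ θ =>
        read c hc (hcle.trans (min_le_right _ _)) U hU hU3 β hβ hβc μ hμ K hK L₀ _ h20 hflat hLu n Λν hΛν hLip Λℓ hΛℓ hLipℓ θ)
      hK hn hren hB θ
  -- the continuation
  exact ct_oneVolume_of_readingHA (L := L₀) (M := max (Mh L₀) (M0 L₀) + 1) (fun _ => W / L₀) hG hQ hμ hR rfl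
    blk hread (fun n hn => (hsplit n hn).1) hS0' hq hroomA hroomB h0 h1 h2

end Summit.HubbardSuperconductivity.HubbardSuperconductivity.Theorems.KLRegimeSplit

end
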